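import Mathlib
import Literature.NumberTheory.LFunctions.Zhang2022.Section7Step7u033Repaired
import Literature.NumberTheory.LFunctions.Zhang2022.Section7TailP2
import Literature.NumberTheory.LFunctions.Zhang2022.Section7Eq711Assembly
import Literature.NumberTheory.LFunctions.Zhang2022.Section7bDischarges
import Literature.NumberTheory.LFunctions.Zhang2022.SkeletonWindowPowers
import Literature.NumberTheory.Sieve.BombieriAsymptoticSieveShiftedPrimes
import HarnessLib

/-!
# Zhang (2022) §7, proof of Proposition 7.1 part (b): the `1 < r < D` total — DISCHARGED
# `Step7bSmallR`: "the total contribution from the terms with `1 < r < D` is `O(P²D^{−c})`"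

Topic `Literature/NumberTheory/LFunctions/Zhang2022` (Landau–Siegel audit tree; verdict-neutral).
Y. Zhang, *Discrete mean estimates and the Landau–Siegel zero*, arXiv:2211.02515v1 (2022)
[Zhang2022LandauSiegel] — **an unrefereed manuscript under adjudication**. D-0069 campaign, cell
`siegel-zhang`, §7 error-term subsection (tex L1984–L2058). The manuscript asserts (tex L2022):
"Thus, on the right side of (7.13), the total contribution from the terms with `1 < r < D` is
`O(P²D^{−c})`" — typed as `Section7cStatements.Step7bSmallR` (slice L2-t4, p412159). As the
adjudication recorded (GAP-LEDGER G-adj2-2, CLOSED-BY `Skeleton.deltaW_rapid_decay`), the printed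
route (Lemma 5.6 on `|t| ≤ D` plus the trivial tail of (7.14)) saves only one power of `D` per
term, while the `r, θ`-aggregation costs `Σ_{r<D} r^{3/2}/φ(hr)`-type sums — the step needs the
rapid decay of `δ(1+it)`, now a tree theorem, consumed here through
`Skeleton.step7u033_repaired`. This file completes the aggregation:

* `frakS_le_pow` — **arbitrary power saving for `𝔰(r,h,d;θ)`**: for every `A` there is a
  threshold beyond which `‖𝔰(r,h,d;θ)‖ ≤ 2·τ₅(d)·hr·P²·D^{−A}` (`1 < r < D`, `θ` primitive,
  `(d,h,r)` in the (7.13) range), from the repaired per-term bound `Skeleton.step7u033_repaired`,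
  the `l > P²` truncation `Section7TailP2.step7bTruncP2_holds`, and
  `|(κ∗a₁)(dl)| ≤ Bτ₅(d)τ₅(l)` (`Section7bStatements.norm_kappaZ_le`), following the `l`-split
  of the landed `step7u034_of`;
* `step7bSmallR_holds` — **the `1 < r < D` total, proved as typed**: per term `frakS_le_pow`
  with `A = 4`; `Σ_{θ (mod r)} 1 ≤ φ(r) ≤ r`; `(√r)⁻¹ ≤ 1`;
  `hr/φ(hr) ≤ (1 + log hr)² ≤ 4𝓛¹⁸` on `hr < P₁`
  (`Literature.NumberTheory.Sieve.natCast_div_totient_le`); the triple sum then factors through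
  `Σ_{d<⌈P₁⌉} τ₅(d)/d · Σ_{h<⌈P₁⌉} 1/h · Σ_{2≤r<D} r ≤ M₅(3𝓛⁹)⁵ · 3𝓛⁹ · D²`
  (`sum_Ico_tau_five_div_le`, the harmonic bound), and
  `𝓛⁷²·D²·D^{−4} ≤ D^{−1}` for `D` large (`Skeleton.exists_mul_ell_pow_le`).

With the landed assembly `eq711_of_eq713_smallR` (`Section7Eq715Holds`) this reduces the cone
leaf `h711` ((7.11), `Section7bStatements.Eq711`) to the SINGLE open hypothesis `Eq713` — the
exact printed-range statement of GAP-LEDGER row G-adj2-1 (the `dhr < P₁` restriction of (7.13),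
typed AS PRINTED with its `AMBIGUITY` flag; this file asserts nothing about it). Theorems only;
0 new definitions; 0 new facts.

WHAT THIS IS NOT: any claim about Theorems 1–2 of the manuscript or about Landau–Siegel zeros;
not a proof of (7.11) or (7.13); no change to the G-adj2-1 row (its range question stays open).

## References

* Y. Zhang, arXiv:2211.02515v1 (2022), §7 pp. 37–38, (7.13)–(7.15), tex L2005–L2030; §5
  Lemmas 5.3, 5.4, 5.6. [cite: Zhang2022LandauSiegel, §7 pp. 37–38]
-/

noncomputable section

open Complex Real Finset

namespace Literature.NumberTheory.LFunctions.Zhang2022.Section7cStatements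

open Literature.NumberTheory.LFunctions.Zhang2022.Skeleton

open scoped Classical

/-! ## Elementary helpers (local copies of private lemmas of the lane, unchanged) -/

/-- `τ_j(mn) ≤ τ_j(m)τ_j(n)` (every divisor of `mn` is a product of a divisor of `m` and a
divisor of `n`; local copy of the lane's submultiplicativity). [folklore] -/
private theorem tau_mul_le' (j m n : ℕ) :
    MeanSquareMajorant.tau j (m * n) ≤ MeanSquareMajorant.tau j m * MeanSquareMajorant.tau j n := by
  induction j generalizing m n with
  | zero =>
    simp only [MeanSquareMajorant.tau_zero, ArithmeticFunction.one_apply, mul_eq_one]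
    by_cases hm : m = 1
    · by_cases hn : n = 1
      · simp [hm, hn]
      · simp [hm, hn]
    · simp [hm]
  | succ j ih =>
    rcases Nat.eq_zero_or_pos m with rfl | hm
    · simp only [zero_mul, ArithmeticFunction.map_zero]
      exact le_of_eq (by ring)
    rcases Nat.eq_zero_or_pos n with rfl | hn
    · simp only [mul_zero, ArithmeticFunction.map_zero]
      exact le_of_eq (by ring)
    rw [MeanSquareMajorant.tau_succ_apply, MeanSquareMajorant.tau_succ_apply,
      MeanSquareMajorant.tau_succ_apply, Finset.sum_mul_sum, ← Finset.sum_product']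
    have hsub : (m * n).divisors ⊆ (m.divisors ×ˢ n.divisors).image (fun x => x.1 * x.2) := by
      intro e he
      have hd := Nat.dvd_of_mem_divisors he
      obtain ⟨e₁, e₂, h₁, h₂, rfl⟩ := Nat.dvd_mul.mp hd
      exact Finset.mem_image.mpr ⟨(e₁, e₂), Finset.mem_product.mpr
        ⟨Nat.mem_divisors.mpr ⟨h₁, hm.ne'⟩, Nat.mem_divisors.mpr ⟨h₂, hn.ne'⟩⟩, rfl⟩
    calc ∑ e ∈ (m * n).divisors, MeanSquareMajorant.tau j e
        ≤ ∑ e ∈ (m.divisors ×ˢ n.divisors).image (fun x => x.1 * x.2), MeanSquareMajorant.tau j e :=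
          Finset.sum_le_sum_of_subset_of_nonneg hsub fun _ _ _ => MeanSquareMajorant.tau_nonneg _ _
      _ ≤ ∑ x ∈ m.divisors ×ˢ n.divisors, MeanSquareMajorant.tau j (x.1 * x.2) :=
          Finset.sum_image_le_of_nonneg fun _ _ => MeanSquareMajorant.tau_nonneg _ _
      _ ≤ ∑ x ∈ m.divisors ×ˢ n.divisors,
            MeanSquareMajorant.tau j x.1 * MeanSquareMajorant.tau j x.2 :=
          Finset.sum_le_sum fun x _ => ih x.1 x.2

/-- `1 ≤ τ₅(l)` for `l ≥ 1` (local copy). [folklore] -/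
private theorem one_le_tau_five {l : ℕ} (hl : l ≠ 0) : 1 ≤ MeanSquareMajorant.tau 5 l := by
  have key : ∀ j : ℕ, 1 ≤ MeanSquareMajorant.tau (j + 1) l := by
    intro j
    induction j with
    | zero => rw [MeanSquareMajorant.tau_one_apply hl]
    | succ j ih =>
      rw [MeanSquareMajorant.tau_succ_apply]
      calc (1 : ℝ) ≤ MeanSquareMajorant.tau (j + 1) l := ih
        _ ≤ ∑ e ∈ l.divisors, MeanSquareMajorant.tau (j + 1) e :=
          Finset.single_le_sum (f := fun e => MeanSquareMajorant.tau (j + 1) e)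
            (fun e _ => MeanSquareMajorant.tau_nonneg (j + 1) e) (Nat.mem_divisors_self l hl)
  exact key 4

/-- Domination of a Dirichlet product from dominations of the factors (local copy). [folklore] -/
private theorem dom_mul' {f g : ArithmeticFunction ℂ} {C₁ C₂ : ℝ} {g₁ g₂ : ArithmeticFunction ℝ}
    (hf : MeanSquareMajorant.Dom (fun n => f n) C₁ g₁)
    (hg : MeanSquareMajorant.Dom (fun n => g n) C₂ g₂) :
    MeanSquareMajorant.Dom (fun n => (f * g) n) (C₁ * C₂) (g₁ * g₂) := by
  intro n hn
  have h := MeanSquareMajorant.dom_seqConv hf hg n hn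
  rw [ArithmeticFunction.mul_apply]
  exact h

/-- `|κ(n)| ≤ τ₄(n)` for `n ≥ 1` (local copy: `κ = n^{−β₁} ∗ n^{−β₂} ∗ n^{−β₃} ∗ μ`, each factor
bounded by `1`). [folklore] -/
private theorem norm_kappaZ_le4 (c' : ℝ) (D : ℕ) {n : ℕ} (hn : n ≠ 0) :
    ‖Skeleton.kappaZ c' D n‖ ≤ MeanSquareMajorant.tau 4 n := by
  have hI : ∀ b : ℝ, MeanSquareMajorant.Dom (fun n => MeanSquareMajorant.powI b n) 1
      (MeanSquareMajorant.tau 1) := fun b =>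
    MeanSquareMajorant.dom_tau_one fun n hn =>
      (MeanSquareMajorant.norm_powI_of_pos b (Nat.pos_of_ne_zero hn)).le
  have hμ : MeanSquareMajorant.Dom
      (fun n => (ArithmeticFunction.moebius : ArithmeticFunction ℂ) n) 1
      (MeanSquareMajorant.tau 1) :=
    MeanSquareMajorant.dom_tau_one fun n _ => norm_moebius_complex_le_one n
  have h := dom_mul' (dom_mul' (dom_mul' (hI (Skeleton.b1 c' D)) (hI (Skeleton.b2 c' D)))
    (hI (Skeleton.b3 c' D))) hμ
  have h' := h n hn
  have htau : MeanSquareMajorant.tau 1 * MeanSquareMajorant.tau 1 * MeanSquareMajorant.tau 1 *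
      MeanSquareMajorant.tau 1 = MeanSquareMajorant.tau 4 := by
    simp only [MeanSquareMajorant.tau]; ring
  rw [htau] at h'
  unfold Skeleton.kappaZ MeanSquareMajorant.kappa
  simpa only [one_mul] using h'

/-- `|(κ∗a)(m)| ≤ B·τ₅(m)` for `|a| ≤ B` (local copy of the lane's domination). [folklore] -/
private theorem norm_conv_kappaZ_le' (c' : ℝ) (D : ℕ) {a : ℕ → ℂ} {B : ℝ} (ha : ∀ n, ‖a n‖ ≤ B)
    (m : ℕ) :
    ‖MeanSquareMajorant.conv (Skeleton.kappaZ c' D) a m‖ ≤ B * MeanSquareMajorant.tau 5 m := by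
  rcases Nat.eq_zero_or_pos m with rfl | hm
  · simp [MeanSquareMajorant.conv]
  have hκ : MeanSquareMajorant.Dom (fun n => Skeleton.kappaZ c' D n) 1 (MeanSquareMajorant.tau 4) :=
    fun n hn => by rw [one_mul]; exact norm_kappaZ_le4 c' D hn
  have haD : MeanSquareMajorant.Dom a B (MeanSquareMajorant.tau 1) :=
    MeanSquareMajorant.dom_tau_one fun n _ => ha n
  have h := MeanSquareMajorant.dom_seqConv hκ haD m hm.ne'
  have htau : MeanSquareMajorant.tau 4 * MeanSquareMajorant.tau 1 = MeanSquareMajorant.tau 5 := by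
    simp only [MeanSquareMajorant.tau]; ring
  rw [htau, one_mul] at h
  exact h

/-- The harmonic bound `Σ_{1≤h<N} 1/h ≤ 1 + log N` (local copy). [folklore] -/
private theorem sum_Ico_inv_le_one_add_log' (N : ℕ) :
    ∑ h ∈ Finset.Ico 1 N, (1 : ℝ) / h ≤ 1 + Real.log N := by
  rcases Nat.lt_or_ge N 2 with hN | hN
  · interval_cases N
    · simp
    · simp
  have hIco : Finset.Ico 1 N = Finset.Icc 1 (N - 1) := by
    ext h; simp only [Finset.mem_Ico, Finset.mem_Icc]; omega
  have h1 : ∑ h ∈ Finset.Icc 1 (N - 1), (1 : ℝ) / h = (harmonic (N - 1) : ℝ) := by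
    rw [harmonic_eq_sum_Icc]; push_cast
    exact Finset.sum_congr rfl fun h _ => by rw [one_div]
  rw [hIco, h1]
  have h2 := harmonic_le_one_add_log (N - 1)
  have h3 : Real.log ((N - 1 : ℕ) : ℝ) ≤ Real.log N :=
    Real.log_le_log (by exact_mod_cast (by omega : 0 < N - 1)) (by exact_mod_cast Nat.sub_le N 1)
  linarith

/-- `log D ≥ 1` once `D ≥ 3` (local copy). [folklore] -/
private theorem one_le_ell' {D : ℕ} (hD : 3 ≤ D) : 1 ≤ Skeleton.ell D := by
  have hD' : (3 : ℝ) ≤ D := by exact_mod_cast hD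
  rw [Skeleton.ell, Real.le_log_iff_exp_le (by linarith)]
  exact le_trans (le_of_lt (lt_trans Real.exp_one_lt_d9 (by norm_num))) hD'

/-- `1 ≤ P` (local copy). [folklore] -/
private theorem one_le_bigP' (D : ℕ) : 1 ≤ Skeleton.bigP D :=
  Real.one_le_exp (by rw [Skeleton.ell]; positivity)

/-- `log P₁ = 0.504·𝓛⁹`. [cite: Zhang2022LandauSiegel, (2.21)] -/
private theorem log_P1_eq (D : ℕ) : Real.log (Skeleton.P1 D) = 0.504 * Skeleton.ell D ^ 9 := by
  rw [Skeleton.P1, Real.log_rpow (lt_of_lt_of_le one_pos (one_le_bigP' D)), Skeleton.bigP,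
    Real.log_exp]

/-! ## `𝔰(r,h,d;θ)` with an arbitrary power saving -/

set_option maxHeartbeats 400000 in
/-- **Arbitrary power saving for `𝔰(r,h,d;θ)` on `1 < r < D` (the G-adj2-2 aggregation input).**
For every `A` and `B`, for all sufficiently large `D` with (A), every `a₁` with (7.2), every
triple `(d,h,r)` of the (7.13) range with `r < D` and every primitive `θ (mod r)`:
`‖𝔰(r,h,d;θ)‖ ≤ 2·τ₅(d)·hr·P²·D^{−A}`. Proof: split the `l`-series of `𝔰` at `P²` (the split of
the landed `step7u034_of`); the tail is `‖tail7P2‖ ≤ exp(−c𝓛¹⁰) ≤ τ₅(d)·hr·P²·D^{−A}` eventually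
(`Section7TailP2.step7bTruncP2_holds`); for `l ≤ P²`, `|(κ∗a₁)(dl)| ≤ Bτ₅(d)τ₅(l)` and the
repaired per-term bound `Skeleton.step7u033_repaired` (the `deltaW_rapid_decay` route) give
`‖f l‖ ≤ Bτ₅(d)τ₅(l)·C'·(hr/l)·P²·D^{−(A+1)}`; then `Σ_{l≤P²} τ₅(l)/l ≤ M₅(3𝓛⁹)⁵` and
`B·C'·M₅·3⁵·𝓛⁴⁵ ≤ D` for `D` large (`Skeleton.exists_mul_ell_pow_le`) absorb the `𝓛`-powers
into one power of `D`. [cite: Zhang2022LandauSiegel, §7 pp. 37–38, tex L2008–L2022] -/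
theorem frakS_le_pow (c' : ℝ) (A : ℕ) (B : ℝ) :
    Skeleton.ForAllLarge fun D _ χ => Skeleton.AssumptionA D χ →
      ∀ a₁ : ℕ → ℂ, Skeleton.Adm72 D B a₁ →
        ∀ (d h r : ℕ) (θ : DirichletCharacter ℂ r), (d, h, r) ∈ tripleSet D → r < D →
          θ.IsPrimitive →
            ‖frakS c' D a₁ r h d θ‖ ≤
              2 * MeanSquareMajorant.tau 5 d * ((h * r : ℕ) : ℝ) * Skeleton.bigP D ^ 2 *
                (D : ℝ) ^ (-(A : ℝ)) := by
  classical
  obtain ⟨cT, hcT, DT, hTail⟩ := Section7TailP2.step7bTruncP2_holds c' B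
  obtain ⟨CR, DR, hRep⟩ := Skeleton.step7u033_repaired c' (A + 1)
  set K := MeanSquareMajorant.majorantConst 5 5 with hK
  have hK0 : 0 < K := MeanSquareMajorant.majorantConst_pos _ _
  obtain ⟨Dabs, habs⟩ := Skeleton.exists_mul_ell_pow_le 45
    (show (0 : ℝ) ≤ max B 0 * max CR 0 * K * 3 ^ 5 by positivity)
  obtain ⟨Dtail, htail9⟩ := Skeleton.exists_nat_forall_le_ell ((A : ℝ) / cT + 1)
  refine ⟨DT + DR + Dabs + Dtail + 3, fun D _ χ hD hq hp hA a₁ ha d h r θ hx hrD hθ => ?_⟩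
  have hDT : DT ≤ D := by omega
  have hDR : DR ≤ D := by omega
  have hDabs : Dabs ≤ D := by omega
  have hDtail : Dtail ≤ D := by omega
  have hD3 : 3 ≤ D := by omega
  -- the triple `(d, h, r)`: `d, h ≥ 1`, `r ≥ 2`
  have hx' := hx
  simp only [tripleSet, Finset.mem_filter, Finset.mem_product, Finset.mem_Ico] at hx'
  obtain ⟨⟨⟨hd1, -⟩, ⟨hh1, -⟩, ⟨hr2, -⟩⟩, -⟩ := hx'
  have hd : 0 < d := hd1
  have hh : 0 < h := hh1
  have h1r : 1 < r := hr2
  have hr : 0 < r := by omega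
  -- sizes
  have hL1 : 1 ≤ Skeleton.ell D := one_le_ell' hD3
  have hP1 : 1 ≤ Skeleton.bigP D := one_le_bigP' D
  set L := Skeleton.ell D with hLdef
  set P := Skeleton.bigP D with hPdef
  set τ := MeanSquareMajorant.tau 5 d with hτdef
  have hL0 : 0 ≤ L := zero_le_one.trans hL1
  have hD0 : (0 : ℝ) < D := by exact_mod_cast (show 0 < D by omega)
  have hτ1 : 1 ≤ τ := one_le_tau_five (by omega)
  have hτ0 : 0 ≤ τ := zero_le_one.trans hτ1
  have hhr1 : (1 : ℝ) ≤ ((h * r : ℕ) : ℝ) := by exact_mod_cast Nat.mul_pos hh hr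
  -- the summands of `𝔰` and of its tail (the `step7u034_of` split)
  set S : ℕ → ℂ := fun l => ∑ p ∈ Skeleton.primeWindow D,
      (p : ℂ) ^ Skeleton.beta3 c' D * θ⁻¹ (p : ZMod r) *
        Skeleton.DeltaW D ((l : ℝ) / ((p : ℝ) * h * r)) with hSdef
  set f : ℕ → ℂ := fun l => if Nat.Coprime l h then
      MeanSquareMajorant.conv (Skeleton.kappaZ c' D) a₁ (d * l) * θ (l : ZMod r) * S l else 0
    with hfdef
  set tl : ℕ → ℂ := fun l => if P ^ 2 < (l : ℝ) ∧ Nat.Coprime l h then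
      MeanSquareMajorant.conv (Skeleton.kappaZ c' D) a₁ (d * l) * θ (l : ZMod r) * S l else 0
    with htldef
  have hfrakS : frakS c' D a₁ r h d θ = ∑' l, f l := rfl
  have htail : tail7P2 c' D a₁ r h d θ = ∑' l, tl l := rfl
  have hRHS0 : 0 ≤ 2 * τ * ((h * r : ℕ) : ℝ) * P ^ 2 * (D : ℝ) ^ (-(A : ℝ)) := by positivity
  by_cases hsum : Summable f
  swap
  · rw [hfrakS, tsum_eq_zero_of_not_summable hsum, norm_zero]; exact hRHS0
  set N := ⌊P ^ 2⌋₊ with hNdef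
  set g : ℕ → ℂ := fun l => f l - tl l with hgdef
  have hg_zero : ∀ l ∉ Finset.range (N + 1), g l = 0 := by
    intro l hl
    have hlN : N + 1 ≤ l := by simpa [Finset.mem_range, not_lt] using hl
    have hlP : P ^ 2 < (l : ℝ) := Nat.lt_of_floor_lt (by omega)
    simp only [hgdef, hfdef, htldef, hlP, true_and, sub_self]
  have hg_sum : Summable g := summable_of_ne_finset_zero hg_zero
  have htl_sum : Summable tl := by
    refine (hsum.sub hg_sum).congr fun l => ?_
    simp only [hgdef]; ring
  have hsplit : frakS c' D a₁ r h d θ =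
      ∑ l ∈ Finset.range (N + 1), g l + tail7P2 c' D a₁ r h d θ := by
    rw [hfrakS, htail]
    have e1 : ∑' l, f l = ∑' l, (g l + tl l) := tsum_congr fun l => by simp only [hgdef]; ring
    rw [e1, hg_sum.tsum_add htl_sum, tsum_eq_sum hg_zero]
  have hg_eq : ∀ l ∈ Finset.range (N + 1), g l = f l := by
    intro l hl
    have hlN : l ≤ N := by simpa [Finset.mem_range, Nat.lt_succ_iff] using hl
    have hlP : ¬ (P ^ 2 < (l : ℝ)) :=
      not_lt.2 (le_trans (by exact_mod_cast hlN) (Nat.floor_le (by positivity)))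
    simp only [hgdef, htldef, hlP, false_and, if_false, sub_zero]
  -- per-`l` bound on the head, from the REPAIRED `§7.u033`
  have hf_bound : ∀ l ∈ Finset.range (N + 1), ‖f l‖ ≤
      max B 0 * max CR 0 * τ * ((h * r : ℕ) : ℝ) * P ^ 2 * (D : ℝ) ^ (-((A : ℝ) + 1)) *
        (MeanSquareMajorant.tau 5 l / l) := by
    intro l hl
    rcases Nat.eq_zero_or_pos l with rfl | hl0
    · simp [hfdef, MeanSquareMajorant.conv]
    have hS : ‖S l‖ ≤ CR * (((h * r : ℕ) : ℝ) / l) * P ^ 2 * (D : ℝ) ^ (-((A : ℝ) + 1)) := by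
      have hh' := hRep D χ hDR hq hp hA r h l θ h1r hrD hθ hh hl0
      have hcast : (-((A + 1 : ℕ) : ℝ)) = -((A : ℝ) + 1) := by push_cast; ring
      rw [hcast] at hh'
      exact hh'
    have hS' : ‖S l‖ ≤ max CR 0 * (((h * r : ℕ) : ℝ) / l) * P ^ 2 *
        (D : ℝ) ^ (-((A : ℝ) + 1)) := by
      refine hS.trans ?_
      have hfac : (0 : ℝ) ≤ (((h * r : ℕ) : ℝ) / l) * P ^ 2 * (D : ℝ) ^ (-((A : ℝ) + 1)) := by
        positivity
      calc CR * (((h * r : ℕ) : ℝ) / l) * P ^ 2 * (D : ℝ) ^ (-((A : ℝ) + 1))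
          = CR * ((((h * r : ℕ) : ℝ) / l) * P ^ 2 * (D : ℝ) ^ (-((A : ℝ) + 1))) := by ring
        _ ≤ max CR 0 * ((((h * r : ℕ) : ℝ) / l) * P ^ 2 * (D : ℝ) ^ (-((A : ℝ) + 1))) :=
            mul_le_mul_of_nonneg_right (le_max_left _ _) hfac
        _ = max CR 0 * (((h * r : ℕ) : ℝ) / l) * P ^ 2 * (D : ℝ) ^ (-((A : ℝ) + 1)) := by ring
    have hconv : ‖MeanSquareMajorant.conv (Skeleton.kappaZ c' D) a₁ (d * l)‖ ≤
        max B 0 * (τ * MeanSquareMajorant.tau 5 l) := by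
      calc ‖MeanSquareMajorant.conv (Skeleton.kappaZ c' D) a₁ (d * l)‖
          ≤ B * MeanSquareMajorant.tau 5 (d * l) := norm_conv_kappaZ_le' c' D ha.1 (d * l)
        _ ≤ max B 0 * MeanSquareMajorant.tau 5 (d * l) :=
            mul_le_mul_of_nonneg_right (le_max_left _ _) (MeanSquareMajorant.tau_nonneg _ _)
        _ ≤ max B 0 * (τ * MeanSquareMajorant.tau 5 l) :=
            mul_le_mul_of_nonneg_left (tau_mul_le' 5 d l) (le_max_right _ _)
    have hfl : ‖f l‖ ≤ ‖MeanSquareMajorant.conv (Skeleton.kappaZ c' D) a₁ (d * l)‖ * 1 * ‖S l‖ := by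
      simp only [hfdef]
      split_ifs with hc
      · rw [norm_mul, norm_mul]
        gcongr
        exact DirichletCharacter.norm_le_one _ _
      · rw [norm_zero]; positivity
    have hτl : 0 ≤ MeanSquareMajorant.tau 5 l := MeanSquareMajorant.tau_nonneg _ _
    calc ‖f l‖ ≤ ‖MeanSquareMajorant.conv (Skeleton.kappaZ c' D) a₁ (d * l)‖ * 1 * ‖S l‖ := hfl
      _ ≤ max B 0 * (τ * MeanSquareMajorant.tau 5 l) * 1 *
            (max CR 0 * (((h * r : ℕ) : ℝ) / l) * P ^ 2 * (D : ℝ) ^ (-((A : ℝ) + 1))) :=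
          mul_le_mul (mul_le_mul_of_nonneg_right hconv zero_le_one) hS' (norm_nonneg _)
            (mul_nonneg (mul_nonneg (le_max_right _ _) (mul_nonneg hτ0 hτl)) zero_le_one)
      _ = max B 0 * max CR 0 * τ * ((h * r : ℕ) : ℝ) * P ^ 2 * (D : ℝ) ^ (-((A : ℝ) + 1)) *
            (MeanSquareMajorant.tau 5 l / l) := by ring
  -- the `τ₅/l`-sum over the head
  have hN2 : 3 ≤ N + 1 := by
    have hPe : Real.exp 1 ≤ P := by
      rw [show P = Real.exp (L ^ 9) from rfl]; exact Real.exp_le_exp.2 (one_le_pow₀ hL1)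
    have he : (2 : ℝ) < Real.exp 1 := by have := Real.exp_one_gt_d9; linarith
    have h2 : (2 : ℝ) ≤ P ^ 2 := by nlinarith
    have : 2 ≤ N := Nat.le_floor (by exact_mod_cast h2)
    omega
  have hlogN : Real.log ((N + 1 : ℕ) : ℝ) ≤ 3 * L ^ 9 := by
    have hN0 : (0 : ℝ) < ((N + 1 : ℕ) : ℝ) := by positivity
    have hNP : ((N + 1 : ℕ) : ℝ) ≤ 2 * P ^ 2 := by
      push_cast
      have h1 : (N : ℝ) ≤ P ^ 2 := Nat.floor_le (by positivity)
      have h2 : (1 : ℝ) ≤ P ^ 2 := one_le_pow₀ hP1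
      linarith
    have hlogP : Real.log P = L ^ 9 := by
      rw [show P = Real.exp (L ^ 9) from rfl, Real.log_exp]
    have hlog2 : Real.log 2 ≤ 1 := by
      have := Real.log_le_sub_one_of_pos (show (0 : ℝ) < 2 by norm_num)
      linarith
    have h19 : (1 : ℝ) ≤ L ^ 9 := one_le_pow₀ hL1
    calc Real.log ((N + 1 : ℕ) : ℝ) ≤ Real.log (2 * P ^ 2) := Real.log_le_log hN0 hNP
      _ = Real.log 2 + 2 * Real.log P := by
          rw [Real.log_mul (by norm_num) (by positivity), Real.log_pow]; push_cast; ring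
      _ ≤ 1 + 2 * L ^ 9 := by rw [hlogP]; linarith
      _ ≤ 3 * L ^ 9 := by linarith
  have htauSum : ∑ l ∈ Finset.Ico 1 (N + 1), MeanSquareMajorant.tau 5 l / l ≤
      K * 3 ^ 5 * L ^ 45 := by
    calc ∑ l ∈ Finset.Ico 1 (N + 1), MeanSquareMajorant.tau 5 l / l
        ≤ K * Real.log ((N + 1 : ℕ) : ℝ) ^ 5 := sum_Ico_tau_five_div_le hN2
      _ ≤ K * (3 * L ^ 9) ^ 5 :=
          mul_le_mul_of_nonneg_left
            (pow_le_pow_left₀ (Real.log_natCast_nonneg _) hlogN 5) (le_of_lt hK0)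
      _ = K * 3 ^ 5 * L ^ 45 := by ring
  have hcoef0 : 0 ≤ max B 0 * max CR 0 * τ * ((h * r : ℕ) : ℝ) * P ^ 2 *
      (D : ℝ) ^ (-((A : ℝ) + 1)) := by positivity
  have hsum_g : ‖∑ l ∈ Finset.range (N + 1), g l‖ ≤
      max B 0 * max CR 0 * τ * ((h * r : ℕ) : ℝ) * P ^ 2 * (D : ℝ) ^ (-((A : ℝ) + 1)) *
        (K * 3 ^ 5 * L ^ 45) := by
    have hIcc : ∑ l ∈ Finset.Ico 1 (N + 1), MeanSquareMajorant.tau 5 l / (l : ℝ) =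
        ∑ l ∈ Finset.range (N + 1), MeanSquareMajorant.tau 5 l / (l : ℝ) := by
      apply Finset.sum_subset
      · intro x hx'
        rw [Finset.mem_Ico] at hx'; rw [Finset.mem_range]; omega
      · intro x hx' hx''
        rw [Finset.mem_range] at hx'; rw [Finset.mem_Ico] at hx''
        have : x = 0 := by omega
        subst this; simp
    calc ‖∑ l ∈ Finset.range (N + 1), g l‖ ≤ ∑ l ∈ Finset.range (N + 1), ‖g l‖ := norm_sum_le _ _
      _ = ∑ l ∈ Finset.range (N + 1), ‖f l‖ :=
          Finset.sum_congr rfl fun l hl => by rw [hg_eq l hl]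
      _ ≤ ∑ l ∈ Finset.range (N + 1),
            max B 0 * max CR 0 * τ * ((h * r : ℕ) : ℝ) * P ^ 2 * (D : ℝ) ^ (-((A : ℝ) + 1)) *
              (MeanSquareMajorant.tau 5 l / l) :=
          Finset.sum_le_sum hf_bound
      _ = max B 0 * max CR 0 * τ * ((h * r : ℕ) : ℝ) * P ^ 2 * (D : ℝ) ^ (-((A : ℝ) + 1)) *
            ∑ l ∈ Finset.range (N + 1), MeanSquareMajorant.tau 5 l / l := by
          rw [Finset.mul_sum]
      _ ≤ _ := by
          rw [← hIcc]
          exact mul_le_mul_of_nonneg_left htauSum hcoef0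
  -- absorb the `𝓛`-powers into one power of `D`
  have habs' : max B 0 * max CR 0 * K * 3 ^ 5 * L ^ 45 ≤ D := habs D hDabs
  have hhead : ‖∑ l ∈ Finset.range (N + 1), g l‖ ≤
      τ * ((h * r : ℕ) : ℝ) * P ^ 2 * (D : ℝ) ^ (-(A : ℝ)) := by
    have hsplitpow : (D : ℝ) ^ (-((A : ℝ) + 1)) = (D : ℝ) ^ (-(A : ℝ)) * ((D : ℝ))⁻¹ := by
      rw [show (-((A : ℝ) + 1)) = (-(A : ℝ)) + (-1) by ring, Real.rpow_add hD0,
        Real.rpow_neg_one]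
    have hbase : 0 ≤ τ * ((h * r : ℕ) : ℝ) * P ^ 2 * (D : ℝ) ^ (-(A : ℝ)) := by positivity
    have hinv : 0 ≤ ((D : ℝ))⁻¹ := by positivity
    calc ‖∑ l ∈ Finset.range (N + 1), g l‖
        ≤ max B 0 * max CR 0 * τ * ((h * r : ℕ) : ℝ) * P ^ 2 * (D : ℝ) ^ (-((A : ℝ) + 1)) *
            (K * 3 ^ 5 * L ^ 45) := hsum_g
      _ = (max B 0 * max CR 0 * K * 3 ^ 5 * L ^ 45) * ((D : ℝ))⁻¹ *
            (τ * ((h * r : ℕ) : ℝ) * P ^ 2 * (D : ℝ) ^ (-(A : ℝ))) := by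
          rw [hsplitpow]; ring
      _ ≤ (D : ℝ) * ((D : ℝ))⁻¹ * (τ * ((h * r : ℕ) : ℝ) * P ^ 2 * (D : ℝ) ^ (-(A : ℝ))) :=
          mul_le_mul_of_nonneg_right (mul_le_mul_of_nonneg_right habs' hinv) hbase
      _ = τ * ((h * r : ℕ) : ℝ) * P ^ 2 * (D : ℝ) ^ (-(A : ℝ)) := by
          rw [mul_inv_cancel₀ (ne_of_gt hD0), one_mul]
  -- the tail: `exp(−c𝓛¹⁰) ≤ D^{−A}` once `A/cT + 1 ≤ 𝓛`
  have htailb : ‖tail7P2 c' D a₁ r h d θ‖ ≤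
      τ * ((h * r : ℕ) : ℝ) * P ^ 2 * (D : ℝ) ^ (-(A : ℝ)) := by
    have hT := hTail D χ hDT hq hp hA a₁ ha d h r θ hx hθ
    have hLge : (A : ℝ) / cT + 1 ≤ L := htail9 D hDtail
    have hexp : Real.exp (-cT * L ^ 10) ≤ (D : ℝ) ^ (-(A : ℝ)) := by
      rw [Real.rpow_def_of_pos hD0]
      refine Real.exp_le_exp.2 ?_
      have hlogD : Real.log (D : ℝ) = L := rfl
      rw [hlogD]
      have h1 : (A : ℝ) ≤ cT * L := by
        have h2 : (A : ℝ) / cT ≤ L := by linarith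
        calc (A : ℝ) = cT * ((A : ℝ) / cT) := by field_simp
          _ ≤ cT * L := mul_le_mul_of_nonneg_left h2 (le_of_lt hcT)
      have hL8 : (1 : ℝ) ≤ L ^ 8 := one_le_pow₀ hL1
      have h3 : (A : ℝ) * L ≤ cT * L ^ 10 := by
        have hstep : (A : ℝ) * L ≤ (cT * L) * L := mul_le_mul_of_nonneg_right h1 hL0
        have hstep2 : (cT * L) * L ≤ cT * L ^ 10 := by
          have hLL : L * L ≤ L ^ 10 := by
            calc L * L = L ^ 2 := (sq L).symm
              _ = L ^ 2 * 1 := (mul_one _).symm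
              _ ≤ L ^ 2 * L ^ 8 := by
                  exact mul_le_mul_of_nonneg_left hL8 (by positivity)
              _ = L ^ 10 := by ring
          calc (cT * L) * L = cT * (L * L) := by ring
            _ ≤ cT * L ^ 10 := mul_le_mul_of_nonneg_left hLL (le_of_lt hcT)
        exact hstep.trans hstep2
      linarith
    have hP2 : (1 : ℝ) ≤ P ^ 2 := one_le_pow₀ hP1
    calc ‖tail7P2 c' D a₁ r h d θ‖ ≤ Real.exp (-cT * L ^ 10) := by
          simpa using hT
      _ ≤ (D : ℝ) ^ (-(A : ℝ)) := hexp
      _ = 1 * 1 * 1 * (D : ℝ) ^ (-(A : ℝ)) := by ring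
      _ ≤ τ * ((h * r : ℕ) : ℝ) * P ^ 2 * (D : ℝ) ^ (-(A : ℝ)) := by gcongr
  -- combine
  calc ‖frakS c' D a₁ r h d θ‖
      = ‖∑ l ∈ Finset.range (N + 1), g l + tail7P2 c' D a₁ r h d θ‖ := by rw [hsplit]
    _ ≤ ‖∑ l ∈ Finset.range (N + 1), g l‖ + ‖tail7P2 c' D a₁ r h d θ‖ := norm_add_le _ _
    _ ≤ τ * ((h * r : ℕ) : ℝ) * P ^ 2 * (D : ℝ) ^ (-(A : ℝ)) +
          τ * ((h * r : ℕ) : ℝ) * P ^ 2 * (D : ℝ) ^ (-(A : ℝ)) := add_le_add hhead htailb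
    _ = 2 * τ * ((h * r : ℕ) : ℝ) * P ^ 2 * (D : ℝ) ^ (-(A : ℝ)) := by ring

/-! ## The `1 < r < D` total -/

set_option maxHeartbeats 400000 in
/-- **`Z22:(7.15)` lead-in prose, PROVED as typed: "the total contribution from the terms with
`1 < r < D` is `O(P²D^{−c})`" (`Section7cStatements.Step7bSmallR`, tex L2022).** Per term
`frakS_le_pow` with `A = 4`; `Σ_{θ (mod r)} 1 ≤ φ(r) ≤ r`; `(√r)⁻¹ ≤ 1`;
`hr/φ(hr) ≤ (1 + log hr)² ≤ 4𝓛¹⁸` on `hr < P₁`; the triple sum factors through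
`Σ_{d<⌈P₁⌉} τ₅(d)/d · Σ_{h<⌈P₁⌉} 1/h · Σ_{2≤r<D} r ≤ M₅(3𝓛⁹)⁵·3𝓛⁹·D²`, and
`𝓛⁷²·D²·D^{−4} ≤ D^{−1}` for `D` large. This discharges the `Step7bSmallR` hypothesis of the
landed assembly `eq711_of_eq713_smallR`; the cone leaf `h711` ((7.11)) thereby rests on the
single remaining hypothesis `Eq713` (GAP-LEDGER G-adj2-1, untouched here).
[cite: Zhang2022LandauSiegel, §7 p. 38, tex L2022] -/
theorem step7bSmallR_holds (c' : ℝ) : Step7bSmallR c' := by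
  classical
  intro B
  obtain ⟨DS, hS⟩ := frakS_le_pow c' 4 B
  set K := MeanSquareMajorant.majorantConst 5 5 with hK
  have hK0 : 0 < K := MeanSquareMajorant.majorantConst_pos _ _
  obtain ⟨Dabs, habs⟩ := Skeleton.exists_mul_ell_pow_le 72
    (show (0 : ℝ) ≤ 8 * (K * 3 ^ 5) * (3 : ℝ) by positivity)
  obtain ⟨DL, hDL⟩ := Skeleton.exists_nat_forall_le_ell 2
  refine ⟨1, one_pos, 1, DS + Dabs + DL + 3, fun D _ χ hD hq hp hA a₁ ha => ?_⟩
  have hDS : DS ≤ D := by omega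
  have hDabs : Dabs ≤ D := by omega
  have hDDL : DL ≤ D := by omega
  have hD3 : 3 ≤ D := by omega
  have hL1 : 1 ≤ Skeleton.ell D := one_le_ell' hD3
  have hL2 : 2 ≤ Skeleton.ell D := hDL D hDDL
  have hP1 : 1 ≤ Skeleton.bigP D := one_le_bigP' D
  set L := Skeleton.ell D with hLdef
  set P := Skeleton.bigP D with hPdef
  have hL0 : 0 ≤ L := zero_le_one.trans hL1
  have hD0 : (0 : ℝ) < D := by exact_mod_cast (show 0 < D by omega)
  have hP0 : (0 : ℝ) < P := lt_of_lt_of_le one_pos hP1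
  set NP := ⌈Skeleton.P1 D⌉₊ with hNPdef
  have hP1pos : (1 : ℝ) ≤ Skeleton.P1 D := by
    rw [Skeleton.P1]
    exact Real.one_le_rpow hP1 (by norm_num)
  have hP1three : (3 : ℝ) ≤ Skeleton.P1 D := by
    have h19 : (512 : ℝ) ≤ L ^ 9 := by
      calc (512 : ℝ) = 2 ^ 9 := by norm_num
        _ ≤ L ^ 9 := pow_le_pow_left₀ (by norm_num) hL2 9
    have hexp : Real.exp 2 ≤ Real.exp (0.504 * L ^ 9) := by
      refine Real.exp_le_exp.2 (by nlinarith)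
    have he3 : (3 : ℝ) ≤ Real.exp 2 := by
      have h1 := Real.exp_one_gt_d9
      have h2 : Real.exp 2 = Real.exp 1 * Real.exp 1 := by
        rw [← Real.exp_add]; norm_num
      nlinarith
    calc (3 : ℝ) ≤ Real.exp 2 := he3
      _ ≤ Real.exp (0.504 * L ^ 9) := hexp
      _ = Skeleton.P1 D := by
          rw [Skeleton.P1, Real.rpow_def_of_pos hP0, show Real.log P = L ^ 9 from by
            rw [show P = Real.exp (L ^ 9) from rfl, Real.log_exp]]
          ring_nf
  have hNP3 : 3 ≤ NP := by
    have : (3 : ℝ) ≤ (NP : ℝ) := le_trans hP1three (Nat.le_ceil _)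
    exact_mod_cast this
  have hlogNP : Real.log (NP : ℝ) ≤ 2 * L ^ 9 := by
    have hNPle : (NP : ℝ) ≤ 2 * Skeleton.P1 D := by
      calc (NP : ℝ) ≤ Skeleton.P1 D + 1 := le_of_lt (Nat.ceil_lt_add_one (by linarith))
        _ ≤ 2 * Skeleton.P1 D := by linarith
    have hlog2 : Real.log 2 ≤ 1 := by
      have := Real.log_le_sub_one_of_pos (show (0 : ℝ) < 2 by norm_num)
      linarith
    have h19 : (1 : ℝ) ≤ L ^ 9 := one_le_pow₀ hL1
    calc Real.log (NP : ℝ) ≤ Real.log (2 * Skeleton.P1 D) :=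
          Real.log_le_log (by positivity) hNPle
      _ = Real.log 2 + Real.log (Skeleton.P1 D) := Real.log_mul (by norm_num) (by linarith)
      _ = Real.log 2 + 0.504 * L ^ 9 := by rw [log_P1_eq]
      _ ≤ 1 + 0.504 * L ^ 9 := by linarith
      _ ≤ 2 * L ^ 9 := by nlinarith
  -- the majorant of a triple
  have hW0 : ∀ x : ℕ × ℕ × ℕ,
      0 ≤ MeanSquareMajorant.tau 5 x.1 / x.1 * (1 / (x.2.1 : ℝ)) * (x.2.2 : ℝ) := by
    intro x
    have := MeanSquareMajorant.tau_nonneg 5 x.1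
    positivity
  set CONST : ℝ := 8 * L ^ 18 * P ^ 2 * (D : ℝ) ^ (-((4 : ℕ) : ℝ)) with hCONSTdef
  have hCONST0 : 0 ≤ CONST := by positivity
  -- per-term bound
  have hterm : ∀ x ∈ (tripleSet D).filter (fun x => x.2.2 < D),
      term713 c' D a₁ x ≤
        CONST * (MeanSquareMajorant.tau 5 x.1 / x.1 * (1 / (x.2.1 : ℝ)) * (x.2.2 : ℝ)) := by
    rintro ⟨d, h, r⟩ hx
    dsimp only
    obtain ⟨hxT, hxrD⟩ := Finset.mem_filter.mp hx
    have hxT' := hxT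
    simp only [tripleSet, Finset.mem_filter, Finset.mem_product, Finset.mem_Ico] at hxT'
    obtain ⟨⟨⟨hd1, -⟩, ⟨hh1, -⟩, ⟨hr2, -⟩⟩, hdhr⟩ := hxT'
    have hd : 0 < d := hd1
    have hh : 0 < h := hh1
    have hr : 0 < r := by omega
    haveI : NeZero r := ⟨by omega⟩
    have hτ0 : 0 ≤ MeanSquareMajorant.tau 5 d := MeanSquareMajorant.tau_nonneg _ _
    have hDpow0 : (0 : ℝ) < (D : ℝ) ^ (-((4 : ℕ) : ℝ)) := Real.rpow_pos_of_pos hD0 _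
    -- the uniform per-character bound
    set BOUND : ℝ := 2 * MeanSquareMajorant.tau 5 d * ((h * r : ℕ) : ℝ) * P ^ 2 *
        (D : ℝ) ^ (-((4 : ℕ) : ℝ)) with hBOUNDdef
    have hBOUND0 : 0 ≤ BOUND := by positivity
    have hθb : ∀ θ : DirichletCharacter ℂ r, θ.IsPrimitive →
        ‖frakS c' D a₁ r h d θ‖ ≤ BOUND := fun θ hθ =>
      hS D χ hDS hq hp hA a₁ ha d h r θ hxT (by exact_mod_cast hxrD) hθ
    -- `Σ*_θ ≤ φ(r)·BOUND ≤ r·BOUND`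
    have hsumθ : (∑ θ : DirichletCharacter ℂ r,
        if θ.IsPrimitive then ‖frakS c' D a₁ r h d θ‖ else 0) ≤ (r : ℝ) * BOUND := by
      have h1 : (∑ θ : DirichletCharacter ℂ r,
          if θ.IsPrimitive then ‖frakS c' D a₁ r h d θ‖ else 0) ≤
          ∑ _θ : DirichletCharacter ℂ r, BOUND := by
        refine Finset.sum_le_sum fun θ _ => ?_
        split_ifs with hθ
        · exact hθb θ hθ
        · exact hBOUND0
      have h2 : (∑ _θ : DirichletCharacter ℂ r, BOUND) =
          (Fintype.card (DirichletCharacter ℂ r) : ℝ) * BOUND := by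
        rw [Finset.sum_const, Finset.card_univ, nsmul_eq_mul]
      have h3 : (Fintype.card (DirichletCharacter ℂ r) : ℝ) ≤ (r : ℝ) := by
        have hcard : Fintype.card (DirichletCharacter ℂ r) = r.totient := by
          rw [← Nat.card_eq_fintype_card,
            DirichletCharacter.card_eq_totient_of_hasEnoughRootsOfUnity ℂ r]
        rw [hcard]
        exact_mod_cast Nat.totient_le r
      calc (∑ θ : DirichletCharacter ℂ r,
            if θ.IsPrimitive then ‖frakS c' D a₁ r h d θ‖ else 0)
          ≤ (Fintype.card (DirichletCharacter ℂ r) : ℝ) * BOUND := h2 ▸ h1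
        _ ≤ (r : ℝ) * BOUND := mul_le_mul_of_nonneg_right h3 hBOUND0
    -- the scalar core: `2hr ≤ 8𝓛¹⁸·φ(hr)·√r`
    have hhr0 : (0 : ℝ) < ((h * r : ℕ) : ℝ) := by exact_mod_cast Nat.mul_pos hh hr
    have htot0 : (0 : ℝ) < (Nat.totient (h * r) : ℝ) := by
      exact_mod_cast Nat.totient_pos.2 (Nat.mul_pos hh hr)
    have hsqrt1 : (1 : ℝ) ≤ Real.sqrt r := by
      rw [show (1 : ℝ) = Real.sqrt 1 from Real.sqrt_one.symm]
      exact Real.sqrt_le_sqrt (by exact_mod_cast hr)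
    have hhrP1 : ((h * r : ℕ) : ℝ) < Skeleton.P1 D := by
      have hstep : ((h * r : ℕ) : ℝ) ≤ ((d * h * r : ℕ) : ℝ) := by
        push_cast
        have hd1' : (1 : ℝ) ≤ d := by exact_mod_cast hd
        have hhr0' : (0 : ℝ) ≤ (h : ℝ) * r := by positivity
        nlinarith
      exact lt_of_le_of_lt hstep hdhr
    have hlog2L9 : (1 + Real.log ((h * r : ℕ) : ℝ)) ^ 2 ≤ 4 * L ^ 18 := by
      have hlog : Real.log ((h * r : ℕ) : ℝ) ≤ L ^ 9 := by
        have h19 : (1 : ℝ) ≤ L ^ 9 := one_le_pow₀ hL1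
        calc Real.log ((h * r : ℕ) : ℝ) ≤ Real.log (Skeleton.P1 D) :=
              Real.log_le_log hhr0 (le_of_lt hhrP1)
          _ = 0.504 * L ^ 9 := log_P1_eq D
          _ ≤ L ^ 9 := by nlinarith
      have hlog0 : 0 ≤ Real.log ((h * r : ℕ) : ℝ) := Real.log_natCast_nonneg _
      have h19 : (1 : ℝ) ≤ L ^ 9 := one_le_pow₀ hL1
      have h1 : 1 + Real.log ((h * r : ℕ) : ℝ) ≤ 2 * L ^ 9 := by linarith
      calc (1 + Real.log ((h * r : ℕ) : ℝ)) ^ 2 ≤ (2 * L ^ 9) ^ 2 :=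
            pow_le_pow_left₀ (by linarith) h1 2
        _ = 4 * L ^ 18 := by ring
    have hweight : ((h * r : ℕ) : ℝ) ≤ 4 * L ^ 18 * (Nat.totient (h * r) : ℝ) := by
      have hnat := Literature.NumberTheory.Sieve.natCast_div_totient_le (h * r)
      rw [div_le_iff₀ htot0] at hnat
      calc ((h * r : ℕ) : ℝ) ≤ (1 + Real.log ((h * r : ℕ) : ℝ)) ^ 2 *
            (Nat.totient (h * r) : ℝ) := hnat
        _ ≤ 4 * L ^ 18 * (Nat.totient (h * r) : ℝ) :=
            mul_le_mul_of_nonneg_right hlog2L9 (le_of_lt htot0)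
    have hscalar : 2 * ((h * r : ℕ) : ℝ) ≤
        8 * L ^ 18 * (Nat.totient (h * r) : ℝ) * Real.sqrt r := by
      calc 2 * ((h * r : ℕ) : ℝ) ≤ 2 * (4 * L ^ 18 * (Nat.totient (h * r) : ℝ)) := by linarith
        _ = 8 * L ^ 18 * (Nat.totient (h * r) : ℝ) * 1 := by ring
        _ ≤ 8 * L ^ 18 * (Nat.totient (h * r) : ℝ) * Real.sqrt r := by
            have hfac : (0 : ℝ) ≤ 8 * L ^ 18 * (Nat.totient (h * r) : ℝ) := by positivity
            exact mul_le_mul_of_nonneg_left hsqrt1 hfac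
    -- assemble
    have hdh0 : (0 : ℝ) < ((d * h : ℕ) : ℝ) := by exact_mod_cast Nat.mul_pos hd hh
    have hsqrt0 : (0 : ℝ) < Real.sqrt r := lt_of_lt_of_le one_pos hsqrt1
    have hAden : (0 : ℝ) < ((d * h : ℕ) : ℝ) * (Nat.totient (h * r) : ℝ) * Real.sqrt r := by
      positivity
    have hterm_eq : term713 c' D a₁ (d, h, r) =
        (((d * h : ℕ) : ℝ) * (Nat.totient (h * r) : ℝ) * Real.sqrt r)⁻¹ *
          ∑ θ : DirichletCharacter ℂ r,
            if θ.IsPrimitive then ‖frakS c' D a₁ r h d θ‖ else 0 := rfl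
    have hstep1 : term713 c' D a₁ (d, h, r) ≤
        (((d * h : ℕ) : ℝ) * (Nat.totient (h * r) : ℝ) * Real.sqrt r)⁻¹ * ((r : ℝ) * BOUND) := by
      rw [hterm_eq]
      exact mul_le_mul_of_nonneg_left hsumθ (by positivity)
    refine hstep1.trans ?_
    rw [inv_mul_le_iff₀ hAden]
    -- goal: `r·BOUND ≤ (dh·φ(hr)·√r)·(CONST·W)`
    have hcommon : (0 : ℝ) ≤ MeanSquareMajorant.tau 5 d * P ^ 2 *
        (D : ℝ) ^ (-((4 : ℕ) : ℝ)) * (r : ℝ) := by positivity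
    have hgoal_eq : (r : ℝ) * BOUND =
        (MeanSquareMajorant.tau 5 d * P ^ 2 * (D : ℝ) ^ (-((4 : ℕ) : ℝ)) * (r : ℝ)) *
          (2 * ((h * r : ℕ) : ℝ)) := by
      rw [hBOUNDdef]; ring
    have hrhs_eq : ((d * h : ℕ) : ℝ) * (Nat.totient (h * r) : ℝ) * Real.sqrt r *
        (CONST * (MeanSquareMajorant.tau 5 d / d * (1 / (h : ℝ)) * (r : ℝ))) =
        (MeanSquareMajorant.tau 5 d * P ^ 2 * (D : ℝ) ^ (-((4 : ℕ) : ℝ)) * (r : ℝ)) *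
          (8 * L ^ 18 * (Nat.totient (h * r) : ℝ) * Real.sqrt r) := by
      rw [hCONSTdef]
      have hd0' : (d : ℝ) ≠ 0 := by positivity
      have hh0' : (h : ℝ) ≠ 0 := by positivity
      push_cast
      field_simp
    rw [hgoal_eq, hrhs_eq]
    exact mul_le_mul_of_nonneg_left hscalar hcommon
  -- the aggregation
  set Sf := (tripleSet D).filter (fun x => x.2.2 < D) with hSfdef
  set Tf := (Finset.Ico 1 NP) ×ˢ ((Finset.Ico 1 NP) ×ˢ (Finset.Ico 2 D)) with hTfdef
  have hsub : Sf ⊆ Tf := by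
    intro x hx
    obtain ⟨hxT, hxrD⟩ := Finset.mem_filter.mp hx
    simp only [tripleSet, Finset.mem_filter, Finset.mem_product, Finset.mem_Ico] at hxT
    obtain ⟨⟨⟨hd1, hdNP⟩, ⟨hh1, hhNP⟩, ⟨hr2, -⟩⟩, -⟩ := hxT
    simp only [hTfdef, Finset.mem_product, Finset.mem_Ico]
    exact ⟨⟨hd1, hdNP⟩, ⟨hh1, hhNP⟩, hr2, hxrD⟩
  have hsum_d : ∑ a ∈ Finset.Ico 1 NP, MeanSquareMajorant.tau 5 a / a ≤ K * 3 ^ 5 * L ^ 45 := by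
    calc ∑ a ∈ Finset.Ico 1 NP, MeanSquareMajorant.tau 5 a / a
        ≤ K * Real.log (NP : ℝ) ^ 5 := sum_Ico_tau_five_div_le hNP3
      _ ≤ K * (2 * L ^ 9) ^ 5 :=
          mul_le_mul_of_nonneg_left
            (pow_le_pow_left₀ (Real.log_natCast_nonneg _) hlogNP 5) (le_of_lt hK0)
      _ = K * 2 ^ 5 * L ^ 45 := by ring
      _ ≤ K * 3 ^ 5 * L ^ 45 := by
          have : (0 : ℝ) ≤ L ^ 45 := by positivity
          nlinarith [hK0.le]
  have hsum_h : ∑ b ∈ Finset.Ico 1 NP, (1 : ℝ) / b ≤ 3 * L ^ 9 := by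
    have h19 : (1 : ℝ) ≤ L ^ 9 := one_le_pow₀ hL1
    calc ∑ b ∈ Finset.Ico 1 NP, (1 : ℝ) / b ≤ 1 + Real.log (NP : ℝ) :=
          sum_Ico_inv_le_one_add_log' NP
      _ ≤ 1 + 2 * L ^ 9 := by linarith [hlogNP]
      _ ≤ 3 * L ^ 9 := by linarith
  have hsum_r : ∑ cc ∈ Finset.Ico 2 D, (cc : ℝ) ≤ (D : ℝ) * (D : ℝ) := by
    calc ∑ cc ∈ Finset.Ico 2 D, (cc : ℝ) ≤ ∑ _cc ∈ Finset.Ico 2 D, (D : ℝ) := by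
          refine Finset.sum_le_sum fun cc hcc => ?_
          have := (Finset.mem_Ico.mp hcc).2
          exact_mod_cast le_of_lt this
      _ = ((Finset.Ico 2 D).card : ℝ) * (D : ℝ) := by
          rw [Finset.sum_const, nsmul_eq_mul]
      _ ≤ (D : ℝ) * (D : ℝ) := by
          have hcard : (Finset.Ico 2 D).card = D - 2 := Nat.card_Ico 2 D
          have : ((D - 2 : ℕ) : ℝ) ≤ (D : ℝ) := by exact_mod_cast Nat.sub_le D 2
          rw [hcard]
          exact mul_le_mul_of_nonneg_right this (by positivity)
  -- factor the product sum
  have hfactor : ∑ x ∈ Tf, MeanSquareMajorant.tau 5 x.1 / x.1 * (1 / (x.2.1 : ℝ)) * (x.2.2 : ℝ) =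
      (∑ a ∈ Finset.Ico 1 NP, MeanSquareMajorant.tau 5 a / a) *
        ((∑ b ∈ Finset.Ico 1 NP, (1 : ℝ) / b) * (∑ cc ∈ Finset.Ico 2 D, (cc : ℝ))) := by
    rw [hTfdef]
    rw [Finset.sum_mul]
    rw [Finset.sum_product]
    refine Finset.sum_congr rfl fun a _ => ?_
    rw [Finset.sum_mul_sum, Finset.mul_sum, Finset.sum_product]
    refine Finset.sum_congr rfl fun b _ => ?_
    rw [Finset.mul_sum]
    refine Finset.sum_congr rfl fun cc _ => ?_
    dsimp only
    ring
  -- final chain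
  have htotal : ∑ x ∈ Sf, term713 c' D a₁ x ≤
      CONST * (K * 3 ^ 5 * L ^ 45 * (3 * L ^ 9 * ((D : ℝ) * (D : ℝ)))) := by
    calc ∑ x ∈ Sf, term713 c' D a₁ x
        ≤ ∑ x ∈ Sf, CONST *
            (MeanSquareMajorant.tau 5 x.1 / x.1 * (1 / (x.2.1 : ℝ)) * (x.2.2 : ℝ)) :=
          Finset.sum_le_sum hterm
      _ = CONST * ∑ x ∈ Sf,
            MeanSquareMajorant.tau 5 x.1 / x.1 * (1 / (x.2.1 : ℝ)) * (x.2.2 : ℝ) := by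
          rw [Finset.mul_sum]
      _ ≤ CONST * ∑ x ∈ Tf,
            MeanSquareMajorant.tau 5 x.1 / x.1 * (1 / (x.2.1 : ℝ)) * (x.2.2 : ℝ) := by
          refine mul_le_mul_of_nonneg_left ?_ hCONST0
          exact Finset.sum_le_sum_of_subset_of_nonneg hsub fun x _ _ => hW0 x
      _ = CONST * ((∑ a ∈ Finset.Ico 1 NP, MeanSquareMajorant.tau 5 a / a) *
            ((∑ b ∈ Finset.Ico 1 NP, (1 : ℝ) / b) * (∑ cc ∈ Finset.Ico 2 D, (cc : ℝ)))) := by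
          rw [hfactor]
      _ ≤ CONST * (K * 3 ^ 5 * L ^ 45 * (3 * L ^ 9 * ((D : ℝ) * (D : ℝ)))) := by
          refine mul_le_mul_of_nonneg_left ?_ hCONST0
          have h1 : (0 : ℝ) ≤ ∑ a ∈ Finset.Ico 1 NP, MeanSquareMajorant.tau 5 a / a := by
            refine Finset.sum_nonneg fun a _ => ?_
            have := MeanSquareMajorant.tau_nonneg 5 a
            positivity
          have h2 : (0 : ℝ) ≤ ∑ b ∈ Finset.Ico 1 NP, (1 : ℝ) / b := by
            refine Finset.sum_nonneg fun b _ => by positivity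
          have h3 : (0 : ℝ) ≤ ∑ cc ∈ Finset.Ico 2 D, (cc : ℝ) := by
            refine Finset.sum_nonneg fun cc _ => by positivity
          have h4 : (0 : ℝ) ≤ 3 * L ^ 9 := by positivity
          have h5 : (0 : ℝ) ≤ K * 3 ^ 5 * L ^ 45 := by positivity
          calc (∑ a ∈ Finset.Ico 1 NP, MeanSquareMajorant.tau 5 a / a) *
                ((∑ b ∈ Finset.Ico 1 NP, (1 : ℝ) / b) * (∑ cc ∈ Finset.Ico 2 D, (cc : ℝ)))
              ≤ (K * 3 ^ 5 * L ^ 45) *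
                ((∑ b ∈ Finset.Ico 1 NP, (1 : ℝ) / b) * (∑ cc ∈ Finset.Ico 2 D, (cc : ℝ))) := by
                exact mul_le_mul_of_nonneg_right hsum_d (mul_nonneg h2 h3)
            _ ≤ (K * 3 ^ 5 * L ^ 45) * ((3 * L ^ 9) * (∑ cc ∈ Finset.Ico 2 D, (cc : ℝ))) := by
                refine mul_le_mul_of_nonneg_left ?_ h5
                exact mul_le_mul_of_nonneg_right hsum_h h3
            _ ≤ (K * 3 ^ 5 * L ^ 45) * ((3 * L ^ 9) * ((D : ℝ) * (D : ℝ))) := by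
                refine mul_le_mul_of_nonneg_left ?_ h5
                exact mul_le_mul_of_nonneg_left hsum_r h4
            _ = K * 3 ^ 5 * L ^ 45 * (3 * L ^ 9 * ((D : ℝ) * (D : ℝ))) := by ring
  -- absorb: `8·K·3⁵·3·𝓛⁷²·D²·D^{−4} ≤ D^{−1}`
  have habs' : 8 * (K * 3 ^ 5) * (3 : ℝ) * L ^ 72 ≤ D := habs D hDabs
  have hpow : (D : ℝ) * (D : ℝ) * (D : ℝ) * (D : ℝ) ^ (-((4 : ℕ) : ℝ)) = (D : ℝ) ^ (-(1 : ℝ)) := by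
    have h3 : (D : ℝ) * (D : ℝ) * (D : ℝ) = (D : ℝ) ^ ((3 : ℕ) : ℝ) := by
      rw [Real.rpow_natCast]; ring
    rw [h3, ← Real.rpow_add hD0]
    norm_num
  calc ∑ x ∈ Sf, term713 c' D a₁ x
      ≤ CONST * (K * 3 ^ 5 * L ^ 45 * (3 * L ^ 9 * ((D : ℝ) * (D : ℝ)))) := htotal
    _ = (8 * (K * 3 ^ 5) * 3 * L ^ 72) *
          ((D : ℝ) * (D : ℝ) * (D : ℝ) ^ (-((4 : ℕ) : ℝ))) * P ^ 2 := by
        rw [hCONSTdef]; ring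
    _ ≤ (D : ℝ) * ((D : ℝ) * (D : ℝ) * (D : ℝ) ^ (-((4 : ℕ) : ℝ))) * P ^ 2 := by
        have hfac : (0 : ℝ) ≤ (D : ℝ) * (D : ℝ) * (D : ℝ) ^ (-((4 : ℕ) : ℝ)) := by positivity
        have hP2 : (0 : ℝ) ≤ P ^ 2 := by positivity
        exact mul_le_mul_of_nonneg_right (mul_le_mul_of_nonneg_right habs' hfac) hP2
    _ = ((D : ℝ) * (D : ℝ) * (D : ℝ) * (D : ℝ) ^ (-((4 : ℕ) : ℝ))) * P ^ 2 := by ring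
    _ = (D : ℝ) ^ (-(1 : ℝ)) * P ^ 2 := by rw [hpow]
    _ = 1 * Skeleton.bigP D ^ 2 * (D : ℝ) ^ (-(1 : ℝ)) := by
        rw [hPdef]; ring
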